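import Summits.Ventures.YMGap.RobustBall.LocalPerturbationDecay
import Literature.MathematicalPhysics.QuantumFieldTheory.Sweep1ShenZhuZhuProofs
import Literature.MathematicalPhysics.QuantumFieldTheory.StrongCouplingClustering
import HarnessLib

/-!
# Venture YMGap, track ROBUST-BALL — ONE STATE AT A RATE: FREE BOUNDARY CONDITIONS — the free-boundary Wilson measure on a finite
# region agrees with the infinite-volume state deep inside the region, exponentially in the depth

HONEST FRAMING. WHAT THIS IS: a venture file (cell `pub-ymgap`, track Y2 ROBUST-BALL, seat ds-3, theorems only), the FREE-BOUNDARY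
reading of `LocalPerturbationDecay.lean`. The free-boundary lattice gauge theory `μ_{Λs,β} = Z⁻¹ e^{−β S_{Λs}} dg_∞` on a finite site
region `Λs ⊆ ℤ^d` (lit `zdWilsonMeasure`, Osterwalder–Seiler 1978 §2.1) satisfies the Wilson DLR equation in every link volume whose
plaquettes have their corners in `Λs` (lit `integral_zdWilsonMeasure_eq_integral_integral_ymSpecification`, Georgii Prop. 2.5); hence
(`BoundaryDecay.bind_eq_of_forall_integral_eq`, bounded continuous functions separate finite Borel measures on the compact metrisable
configuration space) it satisfies the single-link DLR equations `μ_{Λs,β} ∘ γ_{x} = μ_{Λs,β}` at those links, and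
`abs_integral_sub_integral_le_of_localDLR` applies:
* `BoundaryDecay.bind_eq_of_forall_integral_eq` — functional DLR identity on bounded continuous observables at one volume of a Feller
  specification ⇒ `μ ∘ γ_Λ = μ`;
* `zdWilsonMeasure_bind_ymSpecification_eq` — the free measure's single-link (indeed any-volume) DLR equation inside the region;
* ★★ `su2_wilson_free_upTo_oneTwelfth` — `SU(2)` on `ℤ⁴`, `0 ≤ β_W ≤ 1/12` (tree coupling `β_W/2`): for EVERY DLR state `μ`, every
  finite site region `Λs`, every link set `Λ` whose plaquettes have corners in `Λs`, and every Lipschitz cylinder `F` (constant `K`,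
  links `Δ` at depth `≥ D` in `Λ`): `|∫ F dμ^{free}_{Λs, β_W/2} − ∫ F dμ| ≤ 4√2 · K · #Δ · (1/2)^{⌊D⌋}` — FREE boundary conditions
  converge to the one state at rate `log 2` per lattice unit, like every fixed boundary field (`BoundaryDecayBall.lean`);
* ★ `suN_wilson_free_bakryEmery` — every `N ≥ 2`, every `d ≥ 1`, Bakry–Émery window `2(d−1)|β| < 1/2` ('t Hooft `β`, tree `Nβ`),
  `ρ ≥ 6(d−1)|β|/(1/2 − 2(d−1)|β|)`, `ρ < 1`, `ρ' = max(ρ,½)`: `|∫ F dμ^{free}_{Λs, Nβ} − ∫ F dμ| ≤ (2√N/(1 − ρ')) · K · #Δ · ρ'^{⌊D⌋}`.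
WHAT THIS IS NOT: strong-coupling LATTICE statements; nothing about the continuum limit or the Clay Millennium problem.

References: K. Osterwalder, E. Seiler, Ann. Phys. 110 (1978), §2.1; H.-O. Georgii (2011), Prop. 2.5, Thm. 4.17, Thm. 8.20; H. Föllmer,
LNM 1362 (1988), Ch. I, (2.8); lit `Sweep1ShenZhuZhuProofs.lean`, `StrongCouplingClustering.lean`; the seat's `LocalPerturbationDecay.lean`,
`GibbsOfCylinderDLR.lean` (Step 3, followed line by line).
-/

noncomputable section

open MeasureTheory Filter Function ProbabilityTheory Real Topology
open scoped NNReal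
open Literature.Probability.LatticeModels
open Literature.Probability.LatticeModels.DobrushinMetric
open Literature.MathematicalPhysics.QuantumLattice
open Literature.MathematicalPhysics.QuantumFieldTheory hiding ZdEdge
open Summit.QuantumFields.BalabanUV.InfraRed.StrongCouplingPoincareDoorSUN (oneLinkPoincareSUN_bakryEmery)
open Summit.QuantumFields.BalabanUV.InfraRed.StrongCouplingVarianceDoorSUN (oneLinkVarianceBound_bakryEmery)

namespace Summit.Ventures.YMGap.RobustBall

/-! ### Generic: a functional DLR identity on bounded continuous observables is the DLR equation -/

namespace BoundaryDecay

variable {d : ℕ} {G : Type*} [Group G] [TopologicalSpace G] [IsTopologicalGroup G]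
  [MeasurableSpace G] [BorelSpace G] [SecondCountableTopology G]

/-- **Functional DLR identity ⇒ DLR equation** (Georgii 2011, Remark 1.24 with Thm. 4.17, Step 3 of the tree's
`mem_ymGibbsMeasures_of_mem_infiniteVolumeLimitPoints_holds`): for a specification `γ` on `LGConfig d G` with the Feller property at the
volume `Λ` and a probability measure `μ` with `∫ F dμ = ∫ (∫ F dγ_Λ(·|η)) dμ(η)` for every bounded continuous `F`, `μ ∘ γ_Λ = μ` — bounded
continuous functions separate finite Borel measures on the compact metrisable configuration space. [folklore] -/
theorem bind_eq_of_forall_integral_eq {γ : Specification (ZdEdge d) G} (hγ : IsSpecification γ) (Λ : Finset (ZdEdge d))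
    (hFeller : ∀ (F : LGConfig d G → ℝ), Continuous F → ∀ C : ℝ, (∀ U, |F U| ≤ C) → Continuous fun η => ∫ U, F U ∂(γ Λ η))
    {μ : Measure (LGConfig d G)} [IsProbabilityMeasure μ]
    (hDLR : ∀ (F : LGConfig d G → ℝ), Continuous F → ∀ C : ℝ, (∀ U, |F U| ≤ C) → ∫ U, F U ∂μ = ∫ η, (∫ U, F U ∂(γ Λ η)) ∂μ) :
    μ.bind (γ Λ) = μ := by
  haveI hγprob : ∀ η, IsProbabilityMeasure (γ Λ η) := hγ.isProbability Λ
  have hbound : ∀ {F : LGConfig d G → ℝ} {C : ℝ}, (∀ U, |F U| ≤ C) → ∀ η, |∫ U, F U ∂(γ Λ η)| ≤ C :=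
    fun {F C} hC η => by
      have h := norm_integral_le_of_norm_le_const (μ := γ Λ η) (f := F) (C := C)
        (ae_of_all _ fun U => by simpa [Real.norm_eq_abs] using hC U)
      simpa [Real.norm_eq_abs] using h
  have hκ : Measurable (γ Λ) := hγ.measurable_fun Λ
  symm
  refine ext_of_forall_lintegral_eq_of_IsFiniteMeasure fun f => ?_
  have hfm : Measurable fun x => (f x : ENNReal) := measurable_coe_nnreal_ennreal.comp f.continuous.measurable
  rw [Measure.lintegral_bind hκ.aemeasurable hfm.aemeasurable]
  have hfc : Continuous fun x => (f x : ℝ) := NNReal.continuous_coe.comp f.continuous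
  have hfb : ∀ x, |(f x : ℝ)| ≤ nndist f 0 := fun x => by
    rw [abs_of_nonneg (f x).coe_nonneg]
    exact_mod_cast BoundedContinuousFunction.NNReal.upper_bound f x
  have hint : ∀ (m : Measure (LGConfig d G)) [IsFiniteMeasure m],
      ∫⁻ x, (f x : ENNReal) ∂m = ENNReal.ofReal (∫ x, (f x : ℝ) ∂m) := by
    intro m _
    rw [← BoundedContinuousFunction.toReal_lintegral_coe_eq_integral,
      ENNReal.ofReal_toReal (BoundedContinuousFunction.lintegral_lt_top_of_nnreal m f).ne]
  have hpt : (fun η => ∫⁻ x, (f x : ENNReal) ∂(γ Λ η)) = fun η => ENNReal.ofReal (∫ x, (f x : ℝ) ∂(γ Λ η)) :=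
    funext fun η => hint _
  rw [hint μ, hpt, ← ofReal_integral_eq_lintegral_ofReal]
  · rw [hDLR _ hfc _ hfb]
  · exact integrable_of_bound (hFeller _ hfc _ hfb).aestronglyMeasurable (hbound hfb)
  · exact ae_of_all _ fun η => integral_nonneg fun x => (f x).coe_nonneg

end BoundaryDecay

/-! ### The free-boundary Wilson measure satisfies the DLR equation inside its region -/

section Free

variable {d N : ℕ} {G : Type*} [Group G] [TopologicalSpace G] [IsTopologicalGroup G] [CompactSpace G]
  [MeasurableSpace G] [BorelSpace G] [T2Space G] [SecondCountableTopology G]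

/-- **The free-boundary measure solves the Wilson DLR equation at every link volume whose plaquettes have their corners in the region**
(lit `integral_zdWilsonMeasure_eq_integral_integral_ymSpecification` + `bind_eq_of_forall_integral_eq`): `μ^{free}_{Λs,β} ∘ γ_Λ = μ^{free}_{Λs,β}`.
[folklore] -/
theorem zdWilsonMeasure_bind_ymSpecification_eq (ρ : G →* Matrix (Fin N) (Fin N) ℂ) (hρ : Continuous ρ) (β : ℝ)
    (Λs : Finset (Literature.Probability.LatticeModels.Site d)) {Λ : Finset (ZdEdge d)}
    (hΛ : ∀ p ∈ plaquettesTouching Λ, ((p.1, p.2.1.1, p.2.1.2) : Plaq d) ∈ plaquettesIn Λs) :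
    (zdWilsonMeasure (d := d) ρ β Λs).bind (ymSpecification ρ β Λ) = zdWilsonMeasure (d := d) ρ β Λs := by
  haveI := isProbabilityMeasure_zdWilsonMeasure (d := d) ρ hρ β Λs
  exact BoundaryDecay.bind_eq_of_forall_integral_eq (isSpecification_ymSpecification_of_t2Space (d := d) ρ hρ β) Λ
    (fun F hF C hC => continuous_integral_ymSpecification ρ hρ β Λ hF hC)
    fun F hF _ _ => integral_zdWilsonMeasure_eq_integral_integral_ymSpecification ρ hρ β hΛ hF

end Free

/-! ### `SU(2)` on `ℤ⁴`: free boundary conditions converge to the one state at rate `log 2` -/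

section SU2

/-- ★★ **FREE BOUNDARY CONDITIONS, `SU(2)` on `ℤ⁴`, `0 ≤ β_W ≤ 1/12`** (tree coupling `β_W/2`): for EVERY DLR state `μ` of the Wilson
action, every finite site region `Λs`, every finite link set `Λ` all of whose plaquettes have their corners in `Λs`, and every Lipschitz
cylinder `F` (constant `K`, links `Δ` at base-point depth `≥ D` in `Λ`):
`|∫ F dμ^{free}_{Λs, β_W/2} − ∫ F dμ| ≤ 4√2 · K · #Δ · (1/2)^{⌊D⌋}`. [folklore] -/
theorem su2_wilson_free_upTo_oneTwelfth {βW : ℝ} (h0 : 0 ≤ βW) (h : βW ≤ 1 / 12)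
    {μ : Measure (LGConfig 4 (Matrix.specialUnitaryGroup (Fin 2) ℂ))}
    (hμ : μ ∈ ymGibbsMeasures (d := 4) (fundamentalRep (Fin 2)) (βW / 2))
    (Λs : Finset (Literature.Probability.LatticeModels.Site 4)) (Λ : Finset (ZdEdge 4))
    (hΛ : ∀ x ∈ Λ, ∀ p ∈ plaquettesTouching {x}, ((p.1, p.2.1.1, p.2.1.2) : Plaq 4) ∈ plaquettesIn Λs)
    {F : LGConfig 4 (Matrix.specialUnitaryGroup (Fin 2) ℂ) → ℝ} {Δ : Finset (ZdEdge 4)} {K : ℝ≥0}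
    (hF : IsLipschitzCylinder (fundamentalRep (Fin 2)) F Δ K) {D : ℝ}
    (hD : ∀ y ∈ Δ, ∀ z, z ∉ Λ → D ≤ ‖y.1 - z.1‖) :
    |(∫ U, F U ∂(zdWilsonMeasure (d := 4) (fundamentalRep (Fin 2)) (βW / 2) Λs)) - ∫ U, F U ∂μ| ≤
      4 * Real.sqrt 2 * K * Δ.card * (1 / 2 : ℝ) ^ ⌊D⌋₊ := by
  have hρc : Continuous (fundamentalRep (Fin 2)) := continuous_fundamentalRep (Fin 2)
  haveI := isProbabilityMeasure_zdWilsonMeasure (d := 4) (fundamentalRep (Fin 2)) hρc (βW / 2) Λs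
  have hβ : (((2 : ℕ) : ℝ) * (βW / 4) : ℝ) = βW / 2 := by push_cast; ring
  set supp₀ : Finset (ZdEdge 4) → Finset (Finset (ZdEdge 4)) := fun _ => ∅ with hsupp₀
  have hmem : MemBallZd (N := 2) (0 : ℝ) 0 0 (0 : Potential (ZdEdge 4) (Matrix.specialUnitaryGroup (Fin 2) ℂ)) supp₀ :=
    memBallZd_zero le_rfl le_rfl fun _ _ h => by simp [hsupp₀] at h
  have hμ' : μ ∈ perturbedGibbsMeasures (d := 4) (fundamentalRep (Fin 2)) ((2 : ℕ) * (βW / 4)) 0 supp₀ := by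
    rwa [perturbedGibbsMeasures_zero, hβ]
  have hν : ∀ x ∈ Λ, (zdWilsonMeasure (d := 4) (fundamentalRep (Fin 2)) (βW / 2) Λs).bind
      (perturbedYM (d := 4) (fundamentalRep (Fin 2)) ((2 : ℕ) * (βW / 4)) 0 supp₀ {x}) =
        zdWilsonMeasure (d := 4) (fundamentalRep (Fin 2)) (βW / 2) Λs := fun x hx => by
    rw [perturbedYM_zero, hβ]
    exact zdWilsonMeasure_bind_ymSpecification_eq (fundamentalRep (Fin 2)) hρc (βW / 2) Λs (hΛ x hx)
  have key := su2_abs_integral_sub_integral_le_of_localDLR (d := 4) (by norm_num) (ρ := 1 / 2) (ε₀ := 0) (ε₁ := 0) (R := 0)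
    (βW := βW) (by rw [abs_of_nonneg h0, Real.exp_zero, zero_div, Real.exp_zero]; norm_num; linarith) (by norm_num) hmem hμ'
    (zdWilsonMeasure (d := 4) (fundamentalRep (Fin 2)) (βW / 2) Λs) Λ hν hF hD
  rw [max_self, max_eq_left (zero_le_one : (0 : ℝ) ≤ 1), div_one] at key
  refine key.trans (le_of_eq ?_)
  ring

end SU2

/-! ### Every `N ≥ 2`, every `d ≥ 1`: the Bakry–Émery window -/

section SUN

variable {d N : ℕ}

/-- ★ **FREE BOUNDARY CONDITIONS, EVERY `N ≥ 2`, EVERY `d ≥ 1`** (Bakry–Émery window `2(d−1)|β| < 1/2`, 't Hooft `β`, tree coupling `Nβ`):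
with `ρ ≥ 6(d−1)|β|/(1/2 − 2(d−1)|β|)`, `ρ < 1`, `ρ' = max(ρ,½)`, for every DLR state `μ`, every site region `Λs`, every link set `Λ`
whose plaquettes have corners in `Λs`, and every Lipschitz cylinder at depth `≥ D` in `Λ`:
`|∫ F dμ^{free}_{Λs, Nβ} − ∫ F dμ| ≤ (2√N/(1 − ρ')) · K · #Δ · ρ'^{⌊D⌋}`. [folklore] -/
theorem suN_wilson_free_bakryEmery (hd : 1 ≤ d) (hN : 2 ≤ N) {β ρ : ℝ} (hb : |β| * (2 * ((d : ℝ) - 1)) < 1 / 2)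
    (hρ : 6 * ((d : ℝ) - 1) * |β| / (1 / 2 - |β| * (2 * ((d : ℝ) - 1))) ≤ ρ) (hρ1 : ρ < 1)
    {μ : Measure (LGConfig d (Matrix.specialUnitaryGroup (Fin N) ℂ))}
    (hμ : μ ∈ ymGibbsMeasures (d := d) (fundamentalRep (Fin N)) (N * β))
    (Λs : Finset (Literature.Probability.LatticeModels.Site d)) (Λ : Finset (ZdEdge d))
    (hΛ : ∀ x ∈ Λ, ∀ p ∈ plaquettesTouching {x}, ((p.1, p.2.1.1, p.2.1.2) : Plaq d) ∈ plaquettesIn Λs)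
    {F : LGConfig d (Matrix.specialUnitaryGroup (Fin N) ℂ) → ℝ} {Δ : Finset (ZdEdge d)} {K : ℝ≥0}
    (hF : IsLipschitzCylinder (fundamentalRep (Fin N)) F Δ K) {D : ℝ}
    (hD : ∀ y ∈ Δ, ∀ z, z ∉ Λ → D ≤ ‖y.1 - z.1‖) :
    |(∫ U, F U ∂(zdWilsonMeasure (d := d) (fundamentalRep (Fin N)) (N * β) Λs)) - ∫ U, F U ∂μ| ≤
      2 * Real.sqrt N / (1 - max ρ (1 / 2)) * K * Δ.card * (max ρ (1 / 2)) ^ ⌊D⌋₊ := by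
  classical
  haveI : SecondCountableTopology (Matrix (Fin N) (Fin N) ℂ) :=
    inferInstanceAs (SecondCountableTopology (Fin N → Fin N → ℂ))
  haveI : SecondCountableTopology (Matrix.specialUnitaryGroup (Fin N) ℂ) :=
    Topology.IsEmbedding.subtypeVal.secondCountableTopology
  have hρc : Continuous (fundamentalRep (Fin N)) := continuous_fundamentalRep (Fin N)
  haveI := isProbabilityMeasure_zdWilsonMeasure (d := d) (fundamentalRep (Fin N)) hρc (N * β) Λs
  set supp₀ : Finset (ZdEdge d) → Finset (Finset (ZdEdge d)) := fun _ => ∅ with hsupp₀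
  have hmem : MemBallZd (N := N) (0 : ℝ) 0 0 (0 : Potential (ZdEdge d) (Matrix.specialUnitaryGroup (Fin N) ℂ)) supp₀ :=
    memBallZd_zero le_rfl le_rfl fun _ _ h => by simp [hsupp₀] at h
  have hμ' : μ ∈ perturbedGibbsMeasures (d := d) (fundamentalRep (Fin N)) (N * β) 0 supp₀ := by
    rwa [perturbedGibbsMeasures_zero]
  have hν : ∀ x ∈ Λ, (zdWilsonMeasure (d := d) (fundamentalRep (Fin N)) (N * β) Λs).bind
      (perturbedYM (d := d) (fundamentalRep (Fin N)) (N * β) 0 supp₀ {x}) =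
        zdWilsonMeasure (d := d) (fundamentalRep (Fin N)) (N * β) Λs := fun x hx => by
    rw [perturbedYM_zero]
    exact zdWilsonMeasure_bind_ymSpecification_eq (fundamentalRep (Fin N)) hρc (N * β) Λs (hΛ x hx)
  -- the Bakry–Émery door of the zero member
  set b : ℝ := |β| * (2 * ((d : ℝ) - 1)) with hbdef
  have hNpos : (0 : ℝ) < N := by exact_mod_cast (show 0 < N by omega)
  have hgap : 0 < 1 / 2 - b := by linarith
  have hP := oneLinkPoincareSUN_bakryEmery hN hb
  have hV := oneLinkVarianceBound_bakryEmery hN hb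
  have hc : (0 : ℝ) ≤ 1 / ((N : ℝ) * (1 / 2 - b)) := by positivity
  have hv : (0 : ℝ) ≤ (N : ℝ) / (1 / 2 - b) := by positivity
  obtain ⟨osc, lip, hosc, hlip, hosca, hΛl⟩ := hmem.loads
  have hW : (0 : Potential (ZdEdge d) (Matrix.specialUnitaryGroup (Fin N) ℂ)).IsAdapted :=
    fun X => ⟨hmem.dependsOn X, (hmem.continuous X).measurable⟩
  have hWb : ∀ X, ∃ C, ∀ U, |(0 : Potential (ZdEdge d) (Matrix.specialUnitaryGroup (Fin N) ℂ)) X U| ≤ C :=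
    fun X => exists_bound_of_continuous (hmem.continuous X)
  have hKR := isKRContraction_perturbedYM_SU hd (by omega) hc hv le_rfl (fun B hB => hP B hB) (fun B hB => hV B hB) hW
    (supp := supp₀) hosc hosca hlip
  have hsq1 : Real.sqrt (1 / ((N : ℝ) * (1 / 2 - b)) * ((N : ℝ) / (1 / 2 - b))) = 1 / (1 / 2 - b) := by
    rw [show 1 / ((N : ℝ) * (1 / 2 - b)) * ((N : ℝ) / (1 / 2 - b)) = (1 / (1 / 2 - b)) ^ 2 by field_simp,
      Real.sqrt_sq (by positivity)]
  have hrow : ∀ x, ∑ y ∈ perturbedNbr supp₀ x,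
      (exp 0 * Real.sqrt (1 / ((N : ℝ) * (1 / 2 - b)) * ((N : ℝ) / (1 / 2 - b))) * |β| * linkInfluence x y +
        exp (0 / 2) * Real.sqrt (1 / ((N : ℝ) * (1 / 2 - b))) * ∑ X ∈ (supp₀ {x}).filter (fun X => x ∈ X), lip X y) ≤ ρ := by
    intro x
    refine (sum_perturbedNbr_coeff_le hd (β := β) (c := 1 / ((N : ℝ) * (1 / 2 - b))) (v := (N : ℝ) / (1 / 2 - b)) (a := 0)
      hΛl x).trans ?_
    rw [hsq1, Real.exp_zero, zero_div, Real.exp_zero]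
    simp only [one_mul, mul_zero, add_zero]
    calc 6 * ((d : ℝ) - 1) * |β| * (1 / (1 / 2 - b)) = 6 * ((d : ℝ) - 1) * |β| / (1 / 2 - b) := by ring
      _ ≤ ρ := hρ
  have key := abs_integral_sub_integral_le_of_localDLR hW hWb hmem.supportedBy hKR hrow hρ1 hmem.range hμ'
    (zdWilsonMeasure (d := d) (fundamentalRep (Fin N)) (N * β) Λs) Λ hν hF hD
  rwa [max_eq_left (zero_le_one : (0 : ℝ) ≤ 1), div_one] at key

end SUN

end Summit.Ventures.YMGap.RobustBall

end
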